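import Summits.AnomalousDissipation.AnomalousDissipation.Theses.TaylorCertificates
import Summits.AnomalousDissipation.AnomalousDissipation.Theorems.MirrorVarietySteadyWeakIsGlobalLerayHopf

/-!
# Route TaylorCertificates — support `SteadyWeakIsGlobalLerayHopf` (stmt-AnomalousDissipation-14885)

The route decl `TaylorCertificates.SteadyWeakIsGlobalLerayHopf` (the third hypothesis of the route's
deciding theorem `closes`) is, verbatim, the support `MirrorVariety.SteadyWeakIsGlobalLerayHopf`
(stmt-AnomalousDissipation-2992), already proved in
`Theorems/MirrorVarietySteadyWeakIsGlobalLerayHopf.lean` as `steadyWeakIsGlobalLerayHopf_proof`: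
a steady weak solution `u ∈ V` of the forced Navier–Stokes equations on `T³` (`ν > 0`, `f` smooth
with zero mean) satisfying the energy equation `ν ‖∇u‖² = (u, f)`, viewed as the constant path
`t ↦ u`, is a global Leray–Hopf solution from the datum `u`, with long-time means
`meanEnergy = ∫ |u|²` and `meanDissipation = ν ‖∇u‖²` (Galdi 2000, Def. 2.1; Doering–Foias 2002 §2;
Robinson–Rodrigo–Sadowski 2016, Def. 4.9).

The two `def … : Prop` bodies are byte-identical, so the existing proof inhabits the new decl by
definitional unfolding; this file only records that alias under the TaylorCertificates name.
Nothing else is (re)proved here.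
-/

-- `Summit.<Summit>.<Problem>` is the tree's mandated summit-side namespace (CONVENTIONS §2); for this
-- single-conjunct summit the two coincide, so the duplicate is deliberate.
set_option linter.dupNamespace false

namespace Summit.AnomalousDissipation.AnomalousDissipation.Theorems

/-- **Route decl `TaylorCertificates.SteadyWeakIsGlobalLerayHopf` (stmt-AnomalousDissipation-14885),
proved**: a steady weak solution `u ∈ V` of `NS_ν(f)` (`ν > 0`, `f` smooth, mean zero) with the
energy equation `ν ‖∇u‖² = (u, f)`, viewed as the constant path from itself, is a global Leray–Hopf
solution with `meanEnergy = ∫ |u|²` and `meanDissipation = ν ‖∇u‖²`. The statement coincides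
verbatim with `MirrorVariety.SteadyWeakIsGlobalLerayHopf`, so `steadyWeakIsGlobalLerayHopf_proof`
closes it by definitional unfolding. [folklore] -/
theorem taylorCertificates_steadyWeakIsGlobalLerayHopf_proof :
    Summit.AnomalousDissipation.AnomalousDissipation.Theses.TaylorCertificates.SteadyWeakIsGlobalLerayHopf := by
  unfold Summit.AnomalousDissipation.AnomalousDissipation.Theses.TaylorCertificates.SteadyWeakIsGlobalLerayHopf
  exact steadyWeakIsGlobalLerayHopf_proof

end Summit.AnomalousDissipation.AnomalousDissipation.Theorems
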